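import Mathlib
import HarnessLib
import Literature.MathematicalPhysics.QuantumLattice.HubbardFermiRadiusBandContinuous

/-!
# Route `KLProgramme` — ENGINE crux `KLRegimeEngineV17F2` (stmt-HubbardSuperconductivity-20437), row (C) `stub_twoLeg_curvature`,
# producer hypothesis `hcertA : KlwjCertA` — KLWJ-INKERNEL part 1c: THE `D₄` REDUCTION OF THE JET TOWERS TO THE FIRST OCTANT
# (cell gate-hubbard-kl, seat hubbard-kl-k3c5-p1 g21; docket «KLWJ-INKERNEL-ROUTE» (p1b g19 memo 5340b98f1348eb46); 0 kit)

Free band `ε₀(k) = -2(cos k₁ + cos k₂)`; polar level function `F(θ, t)` (`rayDispersion`), radial slope `∂_tF` (`rayDispersionDt`),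
polar Fermi radius `u_μ = bandFermiRadius μ` (`-4 < μ < 0`).  The square lattice's point group acts on the angle by `θ ↦ -θ` and
`θ ↦ θ + π/2`; `F(·, t)`, `∂_tF(·, t)` and the sup norm `‖dir ·‖` are invariant, hence (uniqueness of the polar radius,
`bandFermiRadius_neg`, `bandFermiRadius_add_pi_div_two` of `HubbardFermiRadiusBandContinuous`) so are `u_μ`, the radial slope
along the curve `θ ↦ ∂_tF(θ, u_μ θ)` and the polar Jacobian `θ ↦ u_μ θ / ∂_tF(θ, u_μ θ)` — AS FUNCTIONS of `θ` (p1b's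
`exists_octant_angle` is the pointwise version).  Consequently (`iteratedDeriv_comp_neg`, `iteratedDeriv_comp_add_const`) the
absolute value of every angular derivative of each of the three is
an even, `π/2`-periodic function, and every angle has a representative in the first octant `[0, π/4]` with the same absolute jets
(`exists_octant_absJets`).  This is the reduction that lets a certificate on `θ ∈ [0, π/4]` speak for all angles.
Elementary; nothing here asserts any table entry, row (C), any stub of 20437, K3, U₀, the window, a margin or superconductivity.
References: BGM 2006 §2.4 Lemma 2.1 (2.40) (polar description of the free Fermi curve) [cite: BenfattoGiulianiMastropietro2006].
-/

noncomputable section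

namespace Summit.HubbardSuperconductivity.HubbardSuperconductivity.Theorems.FreeBandJets

set_option linter.dupNamespace false -- summit = problem name (single-conjunct summit), D-0017

open Real Set Literature.MathematicalPhysics.QuantumLattice

/-! ## §1 Even, `π/2`-periodic functions: absolute jets and octant representatives -/

/-- The absolute iterated derivatives of an even function are even. -/
theorem abs_iteratedDeriv_neg_of_even {f : ℝ → ℝ} (hf : ∀ x, f (-x) = f x) (k : ℕ) (x : ℝ) :
    |iteratedDeriv k f (-x)| = |iteratedDeriv k f x| := by
  have h := iteratedDeriv_comp_neg k f x
  have hfe : (fun y => f (-y)) = f := funext hf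
  rw [hfe] at h
  rw [h, smul_eq_mul, abs_mul, abs_pow, abs_neg, abs_one, one_pow, one_mul]

/-- **Octant representative**: an even, `π/2`-periodic function has, at every angle, a point of `[0, π/4]` with the same absolute
iterated derivatives of all orders. -/
theorem exists_octant_absIteratedDeriv {f : ℝ → ℝ} (heven : ∀ x, f (-x) = f x) (hper : Function.Periodic f (π / 2)) (θ : ℝ) :
    ∃ θ₀ ∈ Icc 0 (π / 4), ∀ k, |iteratedDeriv k f θ| = |iteratedDeriv k f θ₀| := by
  have hc : (0 : ℝ) < π / 2 := by positivity
  -- the iterated derivatives are `π/2`-periodic too (`iteratedDeriv_comp_add_const`)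
  have hperk : ∀ k, Function.Periodic (iteratedDeriv k f) (π / 2) := by
    intro k x
    have h := iteratedDeriv_comp_add_const k f (π / 2)
    rw [show (fun y => f (y + π / 2)) = f from funext hper] at h
    exact (congrFun h x).symm
  -- reduce modulo `π/2` into `[0, π/2)`
  set θ₁ := toIcoMod hc 0 θ with hθ₁
  have hmem : θ₁ ∈ Ico 0 (0 + π / 2) := toIcoMod_mem_Ico hc 0 θ
  have hθ₁eq : θ₁ = θ - toIcoDiv hc 0 θ • (π / 2) := (self_sub_toIcoDiv_zsmul hc 0 θ).symm
  have hred : ∀ k, iteratedDeriv k f θ₁ = iteratedDeriv k f θ := by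
    intro k
    rw [hθ₁eq]
    exact (hperk k).sub_zsmul_eq (toIcoDiv hc 0 θ)
  rcases le_or_gt θ₁ (π / 4) with h4 | h4
  · exact ⟨θ₁, ⟨hmem.1, h4⟩, fun k => by rw [hred]⟩
  · -- reflect: `θ₀ = π/2 - θ₁ ∈ (0, π/4)`
    refine ⟨π / 2 - θ₁, ⟨by linarith [hmem.2], by linarith⟩, fun k => ?_⟩
    have h1 : iteratedDeriv k f (θ₁ - π / 2) = iteratedDeriv k f θ₁ := (hperk k).sub_eq θ₁
    rw [← hred k, ← h1, show θ₁ - π / 2 = -(π / 2 - θ₁) by ring, abs_iteratedDeriv_neg_of_even heven]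

/-! ## §2 The radial slope along the curve and the polar Jacobian are `D₄`-invariant; octant representatives -/

section Band

variable {μ : ℝ} (hμ₁ : -4 < μ) (hμ₂ : μ < 0)
include hμ₁ hμ₂

/-- The radial slope along the curve is even in the angle. -/
theorem radialSlope_neg_angle (θ : ℝ) :
    rayDispersionDt (-θ) (bandFermiRadius μ (-θ)) = rayDispersionDt θ (bandFermiRadius μ θ) := by
  rw [bandFermiRadius_neg hμ₁ hμ₂]
  simp only [rayDispersionDt, Real.cos_neg, Real.sin_neg, mul_neg, neg_mul, neg_neg]

/-- The radial slope along the curve is `π/2`-periodic in the angle. -/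
theorem radialSlope_add_pi_div_two (θ : ℝ) :
    rayDispersionDt (θ + π / 2) (bandFermiRadius μ (θ + π / 2)) = rayDispersionDt θ (bandFermiRadius μ θ) := by
  rw [bandFermiRadius_add_pi_div_two hμ₁ hμ₂]
  simp only [rayDispersionDt, Real.cos_add_pi_div_two, Real.sin_add_pi_div_two, mul_neg, Real.sin_neg, neg_mul, neg_neg]
  ring

/-- **Octant representatives for the three jet towers at once**: every angle `θ` has a `θ₀ ∈ [0, π/4]` at which the absolute
values of all angular derivatives of the polar radius `u_μ`, of the radial slope `θ ↦ ∂_tF(θ, u_μ θ)` and of the polar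
Jacobian `θ ↦ u_μ θ / ∂_tF(θ, u_μ θ)` are the same as at `θ`. -/
theorem exists_octant_absJets (θ : ℝ) : ∃ θ₀ ∈ Icc 0 (π / 4), ∀ k,
    |iteratedDeriv k (bandFermiRadius μ) θ| = |iteratedDeriv k (bandFermiRadius μ) θ₀| ∧
    |iteratedDeriv k (fun ϑ => rayDispersionDt ϑ (bandFermiRadius μ ϑ)) θ| =
      |iteratedDeriv k (fun ϑ => rayDispersionDt ϑ (bandFermiRadius μ ϑ)) θ₀| ∧
    |iteratedDeriv k (fun ϑ => bandFermiRadius μ ϑ / rayDispersionDt ϑ (bandFermiRadius μ ϑ)) θ| =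
      |iteratedDeriv k (fun ϑ => bandFermiRadius μ ϑ / rayDispersionDt ϑ (bandFermiRadius μ ϑ)) θ₀| := by
  -- the three functions as one even, periodic vector: run the scalar argument on each with the SAME representative
  have hc : (0 : ℝ) < π / 2 := by positivity
  have hu_even : ∀ x, bandFermiRadius μ (-x) = bandFermiRadius μ x := bandFermiRadius_neg hμ₁ hμ₂
  have hu_per : Function.Periodic (bandFermiRadius μ) (π / 2) := bandFermiRadius_add_pi_div_two hμ₁ hμ₂
  have hD_even : ∀ x, (fun ϑ => rayDispersionDt ϑ (bandFermiRadius μ ϑ)) (-x) =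
      (fun ϑ => rayDispersionDt ϑ (bandFermiRadius μ ϑ)) x := radialSlope_neg_angle hμ₁ hμ₂
  have hD_per : Function.Periodic (fun ϑ => rayDispersionDt ϑ (bandFermiRadius μ ϑ)) (π / 2) :=
    radialSlope_add_pi_div_two hμ₁ hμ₂
  have hJ_even : ∀ x, (fun ϑ => bandFermiRadius μ ϑ / rayDispersionDt ϑ (bandFermiRadius μ ϑ)) (-x) =
      (fun ϑ => bandFermiRadius μ ϑ / rayDispersionDt ϑ (bandFermiRadius μ ϑ)) x := by
    intro x
    have h1 := hD_even x
    have h2 := hu_even x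
    simp only at h1 ⊢
    rw [h1, h2]
  have hJ_per : Function.Periodic (fun ϑ => bandFermiRadius μ ϑ / rayDispersionDt ϑ (bandFermiRadius μ ϑ)) (π / 2) := by
    intro x
    have h1 := hD_per x
    have h2 := hu_per x
    simp only at h1 ⊢
    rw [h1, h2]
  -- iterated derivatives of periodic functions are periodic (`iteratedDeriv_comp_add_const`)
  have hperk : ∀ {g : ℝ → ℝ}, Function.Periodic g (π / 2) → ∀ k, Function.Periodic (iteratedDeriv k g) (π / 2) := by
    intro g hg k x
    have h := iteratedDeriv_comp_add_const k g (π / 2)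
    rw [show (fun y => g (y + π / 2)) = g from funext hg] at h
    exact (congrFun h x).symm
  -- common reduction (same construction as `exists_octant_absIteratedDeriv`, spelled out to share `θ₀`)
  set θ₁ := toIcoMod hc 0 θ with hθ₁
  have hmem : θ₁ ∈ Ico 0 (0 + π / 2) := toIcoMod_mem_Ico hc 0 θ
  have hθ₁eq : θ₁ = θ - toIcoDiv hc 0 θ • (π / 2) := (self_sub_toIcoDiv_zsmul hc 0 θ).symm
  have hred : ∀ {g : ℝ → ℝ}, Function.Periodic g (π / 2) → ∀ k, iteratedDeriv k g θ₁ = iteratedDeriv k g θ := by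
    intro g hg k
    rw [hθ₁eq]
    exact (hperk hg k).sub_zsmul_eq (toIcoDiv hc 0 θ)
  have hrefl : ∀ {g : ℝ → ℝ}, (∀ x, g (-x) = g x) → Function.Periodic g (π / 2) → ∀ k,
      |iteratedDeriv k g θ| = |iteratedDeriv k g (π / 2 - θ₁)| := by
    intro g hge hgp k
    have h1 : iteratedDeriv k g (θ₁ - π / 2) = iteratedDeriv k g θ₁ := (hperk hgp k).sub_eq θ₁
    rw [← hred hgp k, ← h1, show θ₁ - π / 2 = -(π / 2 - θ₁) by ring, abs_iteratedDeriv_neg_of_even hge]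
  rcases le_or_gt θ₁ (π / 4) with h4 | h4
  · exact ⟨θ₁, ⟨hmem.1, h4⟩, fun k => ⟨by rw [hred hu_per], by rw [hred hD_per], by rw [hred hJ_per]⟩⟩
  · exact ⟨π / 2 - θ₁, ⟨by linarith [hmem.2], by linarith⟩, fun k =>
      ⟨hrefl hu_even hu_per k, hrefl hD_even hD_per k, hrefl hJ_even hJ_per k⟩⟩

end Band

end Summit.HubbardSuperconductivity.HubbardSuperconductivity.Theorems.FreeBandJets

end
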